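import Summits.CriticalPhenomena.PercolationContinuityZ3.Theorems.PercNearOneGluingAdditiveGluingFibreSplice
import HarnessLib

/-!
# Crux `PercNearOneGluing.AdditiveGluing` (stmt-CriticalPhenomena-4576), line `tieline`:
# the kernel (T) on its EQUALITY LOCUS — every fibre count vanishes (exact replica-swap involution)

Support file (`--supports stmt-CriticalPhenomena-4576`, helper, seat (d) exchange-certificate form).  No named facts,
no sorries, no definitions.

The registered kernel `stub_k0CovTransferQ_c9` ((T), roles `o b u v c`) follows, weight vector by weight vector, from the
nonnegativity of the weight-free fibre counts `fibreSumT o b u v c I` (`covTransferQ_of_fibres`, file `…FibreCriterion`).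
The census seat ttrl2 (run/shared/lean/ttrl/covT, 2026-08-19; 2.69e9 graphs + all weighted data) found that (T) holds with
EQUALITY exactly on the locus

  `v ∉ O ∧ (b ∉ O ∨ no edge joins O to u)`,   `O` = the component of `o` in `G − {u, c}`

(`G` = the graph of edges with non-trivial weight).  This file PROVES the "⇐" half at the level of fibres and hence for all
weights: if `O ∋ o` is a set of vertices avoiding `u, v, c` such that every allowed edge touching `O` stays inside `O ∪ Z`
with `Z ⊆ {u, c}`, and `b ∉ O` or `u ∉ Z`, then for every count vector `I` supported on the allowed edges
`fibreSumT o b u v c I = 0` (`fibreSumT_eq_zero_of_locus`); consequently the registered inequality (T) holds at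
`(n, w, o, b, u, v, c)` for every weight vector `w` vanishing off the allowed edges (`covTransferQ_of_locus`, via the fibre
criterion restricted to the support, `cubic4_nonneg_of_fibres_supp`).

Mechanism (EXCHCERT-g6 §5, verified there on 103 708 terms; tools in `…FibreSplice`): writing a replica triple as
`(ω¹, ω², ω³)`, the signed summand of `fibreSumT` is `N₁ D₂ D₃ (ub₂ − ub₃)(vo₃ − oc₁·vc₃)`.  Because `Z ⊆ {u, c}` separates `O`
from the rest, on the support `vo₃ = vc₃ ∧ E₃` and `oc₁ = E₁` with `Eᵢ = {o ↔ c by open edges touching O, in ωⁱ}`, while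
every other factor is decided by the edges NOT touching `O` (excursions into `O` return to their entry point because
`u ↮ c` in `ω¹` and in `ω³`).  Swapping the replica labels `1 ↔ 3` on the edges touching `O` is therefore a count-preserving
involution of the fibre exchanging `E₁ ↔ E₃`; it permutes the four indicator terms `A ↔ C`, `B ↔ D` with a sign, so the
fibre sum is `0`.
[folklore] (sign-reversing involution; 2-vertex separator surgery on open paths)
-/

namespace Summit.CriticalPhenomena.PercolationContinuityZ3.Cruxes.AdditiveGluing.TieLine.FibreCount

open MeasureTheory Set Finset Literature.Probability.Percolation
open Literature.Probability.LatticeModels (prodBernoulli)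

open Classical

/-! ### The locus: `{u, c}` separates `o` from `v` (and from `b`, or `b`'s side has no edge to `u`) -/

section Locus

variable {n : ℕ}

/-- If `Z ⊆ {u, c}` and `u, c` are not joined by open edges of `ω ∩ F`, distinct vertices of `Z` are not so joined.
[folklore] -/
theorem pairwise_Z_of_not_reachable {ω F : Set (Sym2 (Fin n))} {Z : Set (Fin n)} {u c : Fin n}
    (hZ : ∀ z ∈ Z, z = u ∨ z = c) (h : ¬ (openGraph (ω ∩ F)).Reachable u c) :
    ∀ z₁ ∈ Z, ∀ z₂ ∈ Z, (openGraph (ω ∩ F)).Reachable z₁ z₂ → z₁ = z₂ := by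
  intro z₁ hz₁ z₂ hz₂ hr
  rcases hZ z₁ hz₁ with rfl | rfl <;> rcases hZ z₂ hz₂ with rfl | rfl
  · rfl
  · exact absurd hr h
  · exact absurd hr.symm h
  · rfl

/-- Under `u ↮ v`: `v ↔ o` iff `v ↔ c` and `o ↔ c` through edges touching `O` (the component side of the separator).
[folklore] -/
theorem reachable_vo_iff {ω F : Set (Sym2 (Fin n))} {O Z : Set (Fin n)} {o u v c : Fin n}
    (hF : ∀ e, e ∈ F ↔ ∃ x ∈ e, x ∈ O) (hO : ∀ e ∈ ω, ∀ x ∈ e, x ∈ O → ∀ y ∈ e, y ∈ O ∨ y ∈ Z)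
    (hZ : ∀ z ∈ Z, z = u ∨ z = c) (ho : o ∈ O) (hv : v ∉ O) (hD : ¬ (openGraph ω).Reachable u v) :
    (openGraph ω).Reachable v o ↔ (openGraph ω).Reachable v c ∧ (openGraph (ω ∩ F)).Reachable o c := by
  constructor
  · intro hvo
    obtain ⟨z, hz, hoz, hzv⟩ := exists_exit_of_not_mem hF hO ho hv hvo.symm
    rcases hZ z hz with rfl | rfl
    · exact absurd hzv hD
    · exact ⟨hzv.symm, hoz⟩
  · rintro ⟨hvc, hoc⟩
    exact hvc.trans (hoc.mono (BHK2006.openGraph_le Set.inter_subset_left)).symm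

/-- Under `c ↮ u`: `o ↔ c` iff `o ↔ c` through edges touching `O`. [folklore] -/
theorem reachable_oc_iff {ω F : Set (Sym2 (Fin n))} {O Z : Set (Fin n)} {o u c : Fin n}
    (hF : ∀ e, e ∈ F ↔ ∃ x ∈ e, x ∈ O) (hO : ∀ e ∈ ω, ∀ x ∈ e, x ∈ O → ∀ y ∈ e, y ∈ O ∨ y ∈ Z)
    (hZ : ∀ z ∈ Z, z = u ∨ z = c) (ho : o ∈ O) (hc : c ∉ O) (hN : ¬ (openGraph ω).Reachable c u) :
    (openGraph ω).Reachable o c ↔ (openGraph (ω ∩ F)).Reachable o c := by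
  constructor
  · intro hoc
    obtain ⟨z, hz, hoz, hzc⟩ := exists_exit_of_not_mem hF hO ho hc hoc
    rcases hZ z hz with rfl | rfl
    · exact absurd hzc.symm hN
    · exact hoz
  · intro hoc
    exact hoc.mono (BHK2006.openGraph_le Set.inter_subset_left)

/-- If `b ∈ O`, `O` is closed modulo `{c}` and `u ↮ c`, then `u ↮ b`. [folklore] -/
theorem not_reachable_ub {ω F : Set (Sym2 (Fin n))} {O Z : Set (Fin n)} {b u c : Fin n}
    (hF : ∀ e, e ∈ F ↔ ∃ x ∈ e, x ∈ O) (hO : ∀ e ∈ ω, ∀ x ∈ e, x ∈ O → ∀ y ∈ e, y ∈ O ∨ y ∈ Z)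
    (hZc : ∀ z ∈ Z, z = c) (hb : b ∈ O) (hu : u ∉ O) (huc : ¬ (openGraph ω).Reachable u c) :
    ¬ (openGraph ω).Reachable u b := by
  intro hub
  obtain ⟨z, hz, _, hzu⟩ := exists_exit_of_not_mem hF hO hb hu hub.symm
  rw [hZc z hz] at hzu
  exact huc hzu.symm

/-- Set algebra of the splice: off `F` it is the first configuration. [folklore] -/
theorem splice_diff (ω ω' F : Set (Sym2 (Fin n))) : ((ω \ F) ∪ (ω' ∩ F)) \ F = ω \ F := by
  ext e; simp only [Set.mem_sdiff, Set.mem_union, Set.mem_inter_iff]; tauto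

/-- Set algebra of the splice: on `F` it is the second configuration. [folklore] -/
theorem splice_inter (ω ω' F : Set (Sym2 (Fin n))) : ((ω \ F) ∪ (ω' ∩ F)) ∩ F = ω' ∩ F := by
  ext e; simp only [Set.mem_sdiff, Set.mem_union, Set.mem_inter_iff]; tauto

/-- The configuration of a coordinatewise splice of two Boolean vectors. [folklore] -/
theorem cfg_ite {ι : Type*} (F : Set ι) (a b : ι → Bool) :
    cfg (fun i => if i ∈ F then b i else a i) = (cfg a \ F) ∪ (cfg b ∩ F) := by
  ext i
  simp only [cfg, Set.mem_setOf_eq, Set.mem_union, Set.mem_sdiff, Set.mem_inter_iff]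
  split_ifs with h <;> simp [h]

/-- The arithmetic of the sign reversal: the four indicator terms are permuted `A ↦ C ↦ A`, `B ↦ D ↦ B`. [folklore] -/
theorem swap_arith (x y e₁ e₃ : Prop) :
    (1 * (if x ∧ e₁ then (1 : ℝ) else 0) + (-1) * (if y ∧ e₁ then (1 : ℝ) else 0) +
        (-1) * (if e₃ ∧ x then (1 : ℝ) else 0) + 1 * (if e₃ ∧ y then (1 : ℝ) else 0)) =
      -(1 * (if x ∧ e₃ then (1 : ℝ) else 0) + (-1) * (if y ∧ e₃ then (1 : ℝ) else 0) +
        (-1) * (if e₁ ∧ x then (1 : ℝ) else 0) + 1 * (if e₁ ∧ y then (1 : ℝ) else 0)) := by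
  by_cases hx : x <;> by_cases hy : y <;> by_cases h1 : e₁ <;> by_cases h3 : e₃ <;> simp [hx, hy, h1, h3]

/-- **The sign reversal.**  Under the locus hypotheses, on every replica triple of a fibre supported on `E₀` where the signed
summand of `fibreSumT` is non-zero, swapping the replica labels `1 ↔ 3` on the edges touching `O` negates the summand.
`Φ` is any map realising that swap coordinatewise (hypotheses `hΦ₁ hΦ₂ hΦ₃`). [folklore] -/
theorem summandT_swap_neg (o b u v c : Fin n) (E₀ F : Set (Sym2 (Fin n))) (O Z : Set (Fin n))
    (hF : ∀ e, e ∈ F ↔ ∃ x ∈ e, x ∈ O) (ho : o ∈ O) (hu : u ∉ O) (hv : v ∉ O) (hc : c ∉ O)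
    (hZ : ∀ z ∈ Z, z = u ∨ z = c) (hE₀ : ∀ e ∈ E₀, ∀ x ∈ e, x ∈ O → ∀ y ∈ e, y ∈ O ∨ y ∈ Z) (hb : b ∉ O ∨ u ∉ Z)
    (I : Sym2 (Fin n) → ℕ) (hI : ∀ e, e ∉ E₀ → I e = 0)
    (Φ : Triple (Sym2 (Fin n)) → Triple (Sym2 (Fin n)))
    (hΦ₁ : ∀ t, (Φ t).1 = fun i => if i ∈ F then t.2.2 i else t.1 i) (hΦ₂ : ∀ t, (Φ t).2.1 = t.2.1)
    (hΦ₃ : ∀ t, (Φ t).2.2 = fun i => if i ∈ F then t.1 i else t.2.2 i)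
    (t : Triple (Sym2 (Fin n))) (ht : cnt t = I)
    (hne : 1 * ind ((openConn c u)ᶜ ∩ (openConn c v)ᶜ) ((openConn u v)ᶜ ∩ openConn u b) ((openConn u v)ᶜ ∩ openConn v o) t +
        (-1) * ind ((openConn c u)ᶜ ∩ (openConn c v)ᶜ) (openConn u v)ᶜ ((openConn u v)ᶜ ∩ openConn u b ∩ openConn v o) t +
        (-1) * ind ((openConn c u)ᶜ ∩ (openConn c v)ᶜ ∩ openConn o c) ((openConn u v)ᶜ ∩ openConn u b)
          ((openConn u v)ᶜ ∩ openConn v c) t +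
        1 * ind ((openConn c u)ᶜ ∩ (openConn c v)ᶜ ∩ openConn o c) (openConn u v)ᶜ
          ((openConn u v)ᶜ ∩ openConn u b ∩ openConn v c) t ≠ 0) :
    1 * ind ((openConn c u)ᶜ ∩ (openConn c v)ᶜ) ((openConn u v)ᶜ ∩ openConn u b) ((openConn u v)ᶜ ∩ openConn v o) (Φ t) +
        (-1) * ind ((openConn c u)ᶜ ∩ (openConn c v)ᶜ) (openConn u v)ᶜ ((openConn u v)ᶜ ∩ openConn u b ∩ openConn v o) (Φ t) +
        (-1) * ind ((openConn c u)ᶜ ∩ (openConn c v)ᶜ ∩ openConn o c) ((openConn u v)ᶜ ∩ openConn u b)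
          ((openConn u v)ᶜ ∩ openConn v c) (Φ t) +
        1 * ind ((openConn c u)ᶜ ∩ (openConn c v)ᶜ ∩ openConn o c) (openConn u v)ᶜ
          ((openConn u v)ᶜ ∩ openConn u b ∩ openConn v c) (Φ t) =
      -(1 * ind ((openConn c u)ᶜ ∩ (openConn c v)ᶜ) ((openConn u v)ᶜ ∩ openConn u b) ((openConn u v)ᶜ ∩ openConn v o) t +
        (-1) * ind ((openConn c u)ᶜ ∩ (openConn c v)ᶜ) (openConn u v)ᶜ ((openConn u v)ᶜ ∩ openConn u b ∩ openConn v o) t +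
        (-1) * ind ((openConn c u)ᶜ ∩ (openConn c v)ᶜ ∩ openConn o c) ((openConn u v)ᶜ ∩ openConn u b)
          ((openConn u v)ᶜ ∩ openConn v c) t +
        1 * ind ((openConn c u)ᶜ ∩ (openConn c v)ᶜ ∩ openConn o c) (openConn u v)ᶜ
          ((openConn u v)ᶜ ∩ openConn u b ∩ openConn v c) t) := by
  obtain ⟨h₁E, -, h₃E⟩ := cfg_subset_of_cnt_eq hI ht
  have hω₁' : cfg (Φ t).1 = (cfg t.1 \ F) ∪ (cfg t.2.2 ∩ F) := by rw [hΦ₁, cfg_ite]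
  have hω₂' : cfg (Φ t).2.1 = cfg t.2.1 := by rw [hΦ₂]
  have hω₃' : cfg (Φ t).2.2 = (cfg t.2.2 \ F) ∪ (cfg t.1 ∩ F) := by rw [hΦ₃, cfg_ite]
  -- unfold the summand's memberships into reachability statements, then name the configurations
  simp only [ind, hω₁', hω₂', hω₃', Set.mem_inter_iff, Set.mem_compl_iff, openConn, Set.mem_setOf_eq] at hne ⊢
  set ω₁ := cfg t.1 with hω₁
  set ω₂ := cfg t.2.1 with hω₂
  set ω₃ := cfg t.2.2 with hω₃
  set ω₁' := (ω₁ \ F) ∪ (ω₃ ∩ F) with hω₁'def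
  set ω₃' := (ω₃ \ F) ∪ (ω₁ ∩ F) with hω₃'def
  -- closedness of all four configurations
  have hO₁ : ∀ e ∈ ω₁, ∀ x ∈ e, x ∈ O → ∀ y ∈ e, y ∈ O ∨ y ∈ Z := closedMod_mono hE₀ h₁E
  have hO₃ : ∀ e ∈ ω₃, ∀ x ∈ e, x ∈ O → ∀ y ∈ e, y ∈ O ∨ y ∈ Z := closedMod_mono hE₀ h₃E
  have hO₁' : ∀ e ∈ ω₁', ∀ x ∈ e, x ∈ O → ∀ y ∈ e, y ∈ O ∨ y ∈ Z :=
    closedMod_mono hE₀ (Set.union_subset (Set.sdiff_subset.trans h₁E) (Set.inter_subset_left.trans h₃E))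
  have hO₃' : ∀ e ∈ ω₃', ∀ x ∈ e, x ∈ O → ∀ y ∈ e, y ∈ O ∨ y ∈ Z :=
    closedMod_mono hE₀ (Set.union_subset (Set.sdiff_subset.trans h₃E) (Set.inter_subset_left.trans h₁E))
  -- Step 1: the three standing constraints hold (else the summand vanishes)
  have hNu : ¬ (openGraph ω₁).Reachable c u := by
    by_contra hN; apply hne; simp [hN]
  have hNv : ¬ (openGraph ω₁).Reachable c v := by
    by_contra hN; apply hne; simp [hN]
  have hD₂ : ¬ (openGraph ω₂).Reachable u v := by
    by_contra hD; apply hne; simp [hD]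
  have hD₃ : ¬ (openGraph ω₃).Reachable u v := by
    by_contra hD; apply hne; simp [hD]
  -- Step 2: `v ↔ c` in replica 3 (else the summand vanishes), hence `u ↮ c` in replica 3
  have hvo₃ := reachable_vo_iff hF hO₃ hZ ho hv hD₃
  have hvc₃ : (openGraph ω₃).Reachable v c := by
    by_contra hvc
    have hvo : ¬ (openGraph ω₃).Reachable v o := fun h' => hvc (hvo₃.1 h').1
    apply hne; simp [hvc, hvo]
  have huc₃ : ¬ (openGraph ω₃).Reachable u c := fun h' => hD₃ (h'.trans hvc₃.symm)
  -- Step 3: the excision hypotheses and the splice equivalences for vertices outside `O`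
  have hZ₁ := pairwise_Z_of_not_reachable (ω := ω₁) (F := F) hZ
    (fun h' => hNu (h'.mono (BHK2006.openGraph_le Set.inter_subset_left)).symm)
  have hZ₃ := pairwise_Z_of_not_reachable (ω := ω₃) (F := F) hZ
    (fun h' => huc₃ (h'.mono (BHK2006.openGraph_le Set.inter_subset_left)))
  have hZ₁' : ∀ z₁ ∈ Z, ∀ z₂ ∈ Z, (openGraph (ω₁' ∩ F)).Reachable z₁ z₂ → z₁ = z₂ := by
    rw [hω₁'def, splice_inter]; exact hZ₃
  have hZ₃' : ∀ z₁ ∈ Z, ∀ z₂ ∈ Z, (openGraph (ω₃' ∩ F)).Reachable z₁ z₂ → z₁ = z₂ := by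
    rw [hω₃'def, splice_inter]; exact hZ₁
  have hag₁ : ω₁ \ F = ω₁' \ F := by rw [hω₁'def, splice_diff]
  have hag₃ : ω₃ \ F = ω₃' \ F := by rw [hω₃'def, splice_diff]
  have out₁ : ∀ {x y : Fin n}, x ∉ O → y ∉ O → ((openGraph ω₁).Reachable x y ↔ (openGraph ω₁').Reachable x y) :=
    fun hx hy => reachable_iff_of_agree_off hF hO₁ hO₁' hZ₁ hZ₁' hag₁ hx hy
  have out₃ : ∀ {x y : Fin n}, x ∉ O → y ∉ O → ((openGraph ω₃).Reachable x y ↔ (openGraph ω₃').Reachable x y) :=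
    fun hx hy => reachable_iff_of_agree_off hF hO₃ hO₃' hZ₃ hZ₃' hag₃ hx hy
  -- transported constraints
  have hNu' : ¬ (openGraph ω₁').Reachable c u := fun h' => hNu ((out₁ hc hu).2 h')
  have hNv' : ¬ (openGraph ω₁').Reachable c v := fun h' => hNv ((out₁ hc hv).2 h')
  have hD₃' : ¬ (openGraph ω₃').Reachable u v := fun h' => hD₃ ((out₃ hu hv).2 h')
  have hvc₃' : (openGraph ω₃').Reachable v c := (out₃ hv hc).1 hvc₃
  -- Step 4: the component-side events `E₁`, `E₃` and the four reachability rewrites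
  have hE₁' : (openGraph (ω₁' ∩ F)).Reachable o c ↔ (openGraph (ω₃ ∩ F)).Reachable o c := by
    rw [hω₁'def, splice_inter]
  have hE₃' : (openGraph (ω₃' ∩ F)).Reachable o c ↔ (openGraph (ω₁ ∩ F)).Reachable o c := by
    rw [hω₃'def, splice_inter]
  have hvo₃' := reachable_vo_iff hF hO₃' hZ ho hv hD₃'
  have hoc₁ := reachable_oc_iff hF hO₁ hZ ho hc hNu
  have hoc₁' := reachable_oc_iff hF hO₁' hZ ho hc hNu'
  -- Step 5: `u ↔ b` is swap-invariant in replica 3 (replica 2 is untouched)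
  have hub₃ : (openGraph ω₃).Reachable u b ↔ (openGraph ω₃').Reachable u b := by
    rcases hb with hbO | huZ
    · exact out₃ hu hbO
    · by_cases hbO : b ∈ O
      · have hZc : ∀ z ∈ Z, z = c := fun z hz => (hZ z hz).resolve_left (by rintro rfl; exact huZ hz)
        have h3 := not_reachable_ub hF hO₃ hZc hbO hu huc₃
        have h3' := not_reachable_ub hF hO₃' hZc hbO hu (fun h' => huc₃ ((out₃ hu hc).2 h'))
        exact ⟨fun h' => absurd h' h3, fun h' => absurd h' h3'⟩
      · exact out₃ hu hbO
  -- Step 6: rewrite everything and conclude with the arithmetic of the swap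
  simp only [hNu, hNv, hNu', hNv', hD₂, hD₃, hD₃', hvo₃, hvo₃', hvc₃, hvc₃', hoc₁, hoc₁', hE₁', hE₃',
    not_false_eq_true, true_and, and_true] at hne ⊢
  rw [← hub₃]
  exact swap_arith _ _ _ _

/-- **The kernel's fibre counts vanish on the locus.**  Let `O ∋ o` avoid `u, v, c`, let `Z ⊆ {u, c}`, suppose
every edge of `E₀` touching `O` stays in `O ∪ Z`, and suppose `b ∉ O` or `u ∉ Z` (i.e. if `b` lies on `o`'s side then no
allowed edge joins `O` to `u`).  Then for every count vector `I` supported on `E₀`, `fibreSumT o b u v c I = 0`.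
(Swap the replica labels `1 ↔ 3` on the edges touching `O`.) [folklore] -/
theorem fibreSumT_eq_zero_of_locus (o b u v c : Fin n) (E₀ : Set (Sym2 (Fin n))) (O Z : Set (Fin n))
    (ho : o ∈ O) (hu : u ∉ O) (hv : v ∉ O) (hc : c ∉ O) (hZ : ∀ z ∈ Z, z = u ∨ z = c)
    (hE₀ : ∀ e ∈ E₀, ∀ x ∈ e, x ∈ O → ∀ y ∈ e, y ∈ O ∨ y ∈ Z) (hb : b ∉ O ∨ u ∉ Z)
    (I : Sym2 (Fin n) → ℕ) (hI : ∀ e, e ∉ E₀ → I e = 0) :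
    fibreSumT o b u v c I = 0 := by
  unfold fibreSumT
  -- the set of edges touching `O`, kept opaque (only its membership characterisation is used)
  obtain ⟨F, hF⟩ : ∃ F : Set (Sym2 (Fin n)), ∀ e, e ∈ F ↔ ∃ x ∈ e, x ∈ O := ⟨{e | ∃ x ∈ e, x ∈ O}, fun _ => Iff.rfl⟩
  set Φ : Triple (Sym2 (Fin n)) → Triple (Sym2 (Fin n)) :=
    fun t => (fun i => if i ∈ F then t.2.2 i else t.1 i, t.2.1, fun i => if i ∈ F then t.1 i else t.2.2 i) with hΦdef
  have hΦ₁ : ∀ t, (Φ t).1 = fun i => if i ∈ F then t.2.2 i else t.1 i := fun _ => rfl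
  have hΦ₂ : ∀ t, (Φ t).2.1 = t.2.1 := fun _ => rfl
  have hΦ₃ : ∀ t, (Φ t).2.2 = fun i => if i ∈ F then t.1 i else t.2.2 i := fun _ => rfl
  refine fibreSum4_eq_zero_of_involution Φ (fun t => ?_) (fun t => ?_) 1 (-1) (-1) 1 _ _ _ _ _ _ _ _ _ _ _ _ I
    (fun t ht hne => summandT_swap_neg o b u v c E₀ F O Z hF ho hu hv hc hZ hE₀ hb I hI Φ hΦ₁ hΦ₂ hΦ₃ t ht hne)
  · -- involution
    obtain ⟨a₁, a₂, a₃⟩ := t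
    ext i
    · simp only [hΦ₁, hΦ₃]; split_ifs <;> rfl
    · simp only [hΦ₂]
    · simp only [hΦ₁, hΦ₃]; split_ifs <;> rfl
  · -- count-preserving
    funext i
    simp only [cnt, cnt3, hΦ₁, hΦ₂, hΦ₃]
    split_ifs
    · omega
    · rfl

end Locus

/-! ### From fibres to weights: the kernel (T) on the locus, for every weight vector supported on `E₀` -/

section Weights

variable {ι : Type*} [Fintype ι]

/-- The fibre weight of a count vector charging a coordinate of weight `0` vanishes. [folklore] -/
theorem fibWt_eq_zero_of_apply_eq_zero (p : ι → unitInterval) (I : ι → ℕ) {i : ι} (hp : ((p i : unitInterval) : ℝ) = 0)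
    (hI : I i ≠ 0) : fibWt p I = 0 := by
  unfold fibWt
  apply Finset.prod_eq_zero (Finset.mem_univ i)
  rw [hp, zero_pow hI, zero_mul]

/-- **The fibre criterion on the support.**  As `cubic4_nonneg_of_fibres`, but the count condition is only required for
count vectors supported on the coordinates of non-zero weight (the other fibres have weight `0`). [folklore] -/
theorem cubic4_nonneg_of_fibres_supp (p : ι → unitInterval) (s₀ s₁ s₂ s₃ : ℝ)
    (A₀ A₁ A₂ B₀ B₁ B₂ C₀ C₁ C₂ D₀ D₁ D₂ : Set (Set ι))
    (h : ∀ I : ι → ℕ, (∀ i, ((p i : unitInterval) : ℝ) = 0 → I i = 0) →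
      0 ≤ fibreSum4 s₀ s₁ s₂ s₃ A₀ A₁ A₂ B₀ B₁ B₂ C₀ C₁ C₂ D₀ D₁ D₂ I) :
    0 ≤ s₀ * ((prodBernoulli p).real A₀ * (prodBernoulli p).real A₁ * (prodBernoulli p).real A₂) +
        s₁ * ((prodBernoulli p).real B₀ * (prodBernoulli p).real B₁ * (prodBernoulli p).real B₂) +
        s₂ * ((prodBernoulli p).real C₀ * (prodBernoulli p).real C₁ * (prodBernoulli p).real C₂) +
        s₃ * ((prodBernoulli p).real D₀ * (prodBernoulli p).real D₁ * (prodBernoulli p).real D₂) := by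
  rw [real_mul_real_mul_real_eq_sum p A₀ A₁ A₂, real_mul_real_mul_real_eq_sum p B₀ B₁ B₂,
    real_mul_real_mul_real_eq_sum p C₀ C₁ C₂, real_mul_real_mul_real_eq_sum p D₀ D₁ D₂,
    Finset.mul_sum, Finset.mul_sum, Finset.mul_sum, Finset.mul_sum, ← Finset.sum_add_distrib, ← Finset.sum_add_distrib,
    ← Finset.sum_add_distrib]
  have hterm : ∀ t : Triple ι,
      s₀ * (fibWt p (cnt t) * ind A₀ A₁ A₂ t) + s₁ * (fibWt p (cnt t) * ind B₀ B₁ B₂ t) +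
          s₂ * (fibWt p (cnt t) * ind C₀ C₁ C₂ t) + s₃ * (fibWt p (cnt t) * ind D₀ D₁ D₂ t) =
        fibWt p (cnt t) * (s₀ * ind A₀ A₁ A₂ t + s₁ * ind B₀ B₁ B₂ t + s₂ * ind C₀ C₁ C₂ t + s₃ * ind D₀ D₁ D₂ t) := by
    intro t; ring
  simp_rw [hterm]
  rw [← Finset.sum_fiberwise_of_maps_to (s := (Finset.univ : Finset (Triple ι))) (t := Finset.univ.image cnt) (g := cnt)
    (fun t ht => Finset.mem_image_of_mem cnt ht)]
  refine Finset.sum_nonneg fun I _ => ?_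
  have hI : ∑ t ∈ (Finset.univ : Finset (Triple ι)).filter (fun t => cnt t = I),
      fibWt p (cnt t) * (s₀ * ind A₀ A₁ A₂ t + s₁ * ind B₀ B₁ B₂ t + s₂ * ind C₀ C₁ C₂ t + s₃ * ind D₀ D₁ D₂ t) =
      fibWt p I * fibreSum4 s₀ s₁ s₂ s₃ A₀ A₁ A₂ B₀ B₁ B₂ C₀ C₁ C₂ D₀ D₁ D₂ I := by
    unfold fibreSum4
    rw [Finset.mul_sum]
    refine Finset.sum_congr rfl fun t ht => ?_
    rw [(Finset.mem_filter.1 ht).2]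
  rw [hI]
  by_cases hsupp : ∀ i, ((p i : unitInterval) : ℝ) = 0 → I i = 0
  · exact mul_nonneg (fibWt_nonneg p I) (h I hsupp)
  · simp only [not_forall] at hsupp
    obtain ⟨i, hp, hIi⟩ := hsupp
    rw [fibWt_eq_zero_of_apply_eq_zero p I hp hIi, zero_mul]

end Weights

section KernelLocus

variable {n : ℕ}

/-- **The kernel (T) on its equality locus.**  Let `w` be a weight vector vanishing off the edge set `E₀`, and let
`O ∋ o` avoid `u, v, c` with every edge of `E₀` touching `O` contained in `O ∪ Z`, `Z ⊆ {u, c}`, and `b ∉ O` or `u ∉ Z`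
(ttrl2's equality locus of (T): `v ∉ O_s ∧ (b ∉ O_s ∨ O_s ⟂ u)`, `O_s` the component of `o` in `G − {u, c}`).  Then the
registered covariance-transfer inequality (T) = `stub_k0CovTransferQ_c9` holds at `(n, w, o, b, u, v, c)`: all its fibre
counts vanish (`fibreSumT_eq_zero_of_locus`) and the fibre criterion on the support applies. [folklore] -/
theorem covTransferQ_of_locus (w : Sym2 (Fin n) → unitInterval) (o b u v c : Fin n) (E₀ : Set (Sym2 (Fin n)))
    (O Z : Set (Fin n)) (hw : ∀ e, e ∉ E₀ → ((w e : unitInterval) : ℝ) = 0)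
    (ho : o ∈ O) (hu : u ∉ O) (hv : v ∉ O) (hc : c ∉ O) (hZ : ∀ z ∈ Z, z = u ∨ z = c)
    (hE₀ : ∀ e ∈ E₀, ∀ x ∈ e, x ∈ O → ∀ y ∈ e, y ∈ O ∨ y ∈ Z) (hb : b ∉ O ∨ u ∉ Z) :
    (prodBernoulli w).real ((openConn u v)ᶜ : Set (BondConfig (Fin n))) *
        ((prodBernoulli w).real ((openConn u v)ᶜ ∩ openConn u b ∩ openConn v o : Set (BondConfig (Fin n))) *
            (prodBernoulli w).real ((openConn c u)ᶜ ∩ (openConn c v)ᶜ : Set (BondConfig (Fin n))) -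
          (prodBernoulli w).real ((openConn u v)ᶜ ∩ openConn u b ∩ openConn v c : Set (BondConfig (Fin n))) *
            (prodBernoulli w).real ((openConn c u)ᶜ ∩ (openConn c v)ᶜ ∩ openConn o c : Set (BondConfig (Fin n)))) ≤
      (prodBernoulli w).real ((openConn u v)ᶜ ∩ openConn u b : Set (BondConfig (Fin n))) *
        ((prodBernoulli w).real ((openConn u v)ᶜ ∩ openConn v o : Set (BondConfig (Fin n))) *
            (prodBernoulli w).real ((openConn c u)ᶜ ∩ (openConn c v)ᶜ : Set (BondConfig (Fin n))) -
          (prodBernoulli w).real ((openConn u v)ᶜ ∩ openConn v c : Set (BondConfig (Fin n))) *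
            (prodBernoulli w).real ((openConn c u)ᶜ ∩ (openConn c v)ᶜ ∩ openConn o c : Set (BondConfig (Fin n)))) := by
  have key := cubic4_nonneg_of_fibres_supp (ι := Sym2 (Fin n)) w 1 (-1) (-1) 1
    ((openConn c u)ᶜ ∩ (openConn c v)ᶜ) ((openConn u v)ᶜ ∩ openConn u b) ((openConn u v)ᶜ ∩ openConn v o)
    ((openConn c u)ᶜ ∩ (openConn c v)ᶜ) (openConn u v)ᶜ ((openConn u v)ᶜ ∩ openConn u b ∩ openConn v o)
    ((openConn c u)ᶜ ∩ (openConn c v)ᶜ ∩ openConn o c) ((openConn u v)ᶜ ∩ openConn u b) ((openConn u v)ᶜ ∩ openConn v c)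
    ((openConn c u)ᶜ ∩ (openConn c v)ᶜ ∩ openConn o c) (openConn u v)ᶜ ((openConn u v)ᶜ ∩ openConn u b ∩ openConn v c)
    (fun I hI => (fibreSumT_eq_zero_of_locus o b u v c E₀ O Z ho hu hv hc hZ hE₀ hb I
      (fun e he => hI e (hw e he))).symm.le)
  nlinarith [key]

end KernelLocus

end Summit.CriticalPhenomena.PercolationContinuityZ3.Cruxes.AdditiveGluing.TieLine.FibreCount
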